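import Summits.QuantumFields.YangMills.Theorems.UnitScaleTiltProp7PinnedOrbitSliceRow
import HarnessLib

/-!
# `MinimiserStabilityRegPr`, route-R E′ — THE ORBIT TEST AT THE DOORS' OWN OBJECTS: no non-trivial small GAUGE COPY `W^w` of the background passes the slice row

Sequel of ✓ `Prop7PinnedOrbitSliceRow` (cell ym3-torus, width seat px15 (gen 2); ★p1 g15 «ORBIT-NEG GO» 2026-08-28T20:35:45Z).  THEOREMS ONLY (0 `def`, 0 `sorry`);
`--supports stmt-QuantumFields-19200 --as helper`, count-neutral, zero credit.  YM₃ on T³ is a ladder rung (R3), not the Clay problem; nothing here refutes the crux, the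
stub or E′ — it refutes one recipe for inhabiting the E′ doors.

THE STEP.  ✓ `Prop7PinnedOrbitSliceRow.pinnedGauge_eq_zero_of_sliceRow` kills every chart `D` that is bondwise second-order close (`‖D_b − Z_b‖ ≤ h‖Z_b‖`) to a pinned pure gauge
`Z_b = ω(b₋) − W_bω(b₊)W_b*`.  Here the closeness is DISCHARGED for the chart the doors actually see at a gauge copy `Y = W^w`: `D_b = (−i)log↑((W^w)_bW_b⁻¹) = (−i)log(w₋W_bw₊*W_b*)`
is `3‖log w(b₋)‖`-close to `Z_b` with `ω := (−i)log∘w` — ✓ `Prop7PinnedRegaugeChartBCH.norm_mlog_twist_sub_pureGauge_le_refined` ([Balaban1985Averaging] (31) refined: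
`‖log(u₋Wu₊*W*) − (μ₋ − Wμ₊W*)‖ ≤ 3‖μ₋‖·‖μ₋ − Wμ₊W*‖`).  So, under the two displayed Poincaré rows for `ω` and the window of file 1, the slice row at `Y = W^w` forces
`(W^w)_b = W_b` on every bond.  With the numerics of LOCATE-MASS-JUNCTION-px15g2 §7 (kit j317584∕j317585: the one-step linear corrector returns `W^{w₂}`, `w₂ ≠ 1`) this is
the kernel face of the ORBIT TEST.

WHAT IS PROVED (ns `…Theorems.Prop7PinnedOrbitSliceRowGaugeCopy`).
* §1 (any `P`, level, `SU(n)`) `coe_gaugeAct_self_mul_inv` (`↑((W^w)_bW_b⁻¹) = w(b₋)·W_b·w(b₊)*·W_b*`), ★ `norm_chart_gaugeCopy_sub_gaugeDir_le`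
  (`‖(−i)log↑((W^w)_bW_b⁻¹) − Z_b‖ ≤ 3‖log w(b₋)‖·‖Z_b‖` for `‖w(b±) − 1‖ ≤ 1∕64`).
* §2 (the doors' carrier: run `K` of a `T3Family`, `SU(2)`) ★★★ `gaugeCopy_eq_of_sliceRow` — `‖w(x) − 1‖ ≤ 1∕64`, `3‖log w(x)‖ ≤ h ≤ 1`, Poincaré rows `Σ‖ω‖² ≤ P₀·DIV_W(iZ)`,
  `Σ‖Z‖² ≤ P₁·DIV_W(iZ)`, window `16ζa²d²P₀ + (64ζ + 16)d·h²P₁ + 8δ₁ℓ⁻²P₁ < 1`, and the slice row of ✓ `stub_PV3E_of_fibrePointSlice` at `D = chart(W^w)` ⇒ `∀ b, (W^w)_b = W_b`.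
HONEST SCOPE.  Bookkeeping over file 1 and the lineage's BCH letters; the Poincaré rows stay displayed (flat sharp sizes are cell numerics).

References: T. Bałaban, CMP 98 (1985) 17–51 [Balaban1985Averaging] ((8), (11) p.19, (21) p.21, (31) p.22); CMP 102 (1985) 277–309 [Balaban1985Variational] ((4), (6) p.278,
(15) p.280, (141)–(143) p.299, Prop. 7 p.299).
-/

set_option autoImplicit false

noncomputable section

open scoped BigOperators Matrix.Norms.L2Operator Matrix
open NormedSpace

namespace Summit.QuantumFields.YangMills.Theorems.Prop7PinnedOrbitSliceRowGaugeCopy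

open Literature.MathematicalPhysics.QuantumFieldTheory.Balaban1983to89
open Literature.MathematicalPhysics.QuantumFieldTheory.Balaban1983to89.T3ContinuumYM3Torus
open MatrixLog (mlog exp_mlog)
open B9Eq39Adjoint (divB)
open B10Eq27TorusAxialLog (unitsField toUField)
open B9TorusCalculus (torusT)
open Summit.QuantumFields.YangMills.Theorems.Prop7PinnedRegaugeChartBCH (norm_mlog_twist_sub_pureGauge_le_refined norm_twist_sub_one_le norm_sub_conj_le)
open Summit.QuantumFields.YangMills.Theorems.Prop7PinnedOrbitSliceRow (pinnedGauge_eq_zero_of_sliceRow)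

/-! ## §1 The chart of a gauge copy against its covariant gauge direction -/

section Letters

variable {n : Type*} [Fintype n] [DecidableEq n] [Nonempty n]
variable {P : Params} {k : ℕ}

/-- `↑((W^w)_b·W_b⁻¹) = w(b₋)·W_b·w(b₊)*·W_b*`. [cite: Balaban1985Variational, (4) p.278, (15) p.280] -/
theorem coe_gaugeAct_self_mul_inv (W : GaugeField P k (Matrix.specialUnitaryGroup n ℂ)) (w : GaugeTransf P k (Matrix.specialUnitaryGroup n ℂ)) (b : PBond P k) :
    (((GaugeField.gaugeAct w W b * (W b)⁻¹ : Matrix.specialUnitaryGroup n ℂ)) : Matrix n n ℂ)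
      = ((w b.src : Matrix.specialUnitaryGroup n ℂ) : Matrix n n ℂ) * ((W b : Matrix.specialUnitaryGroup n ℂ) : Matrix n n ℂ)
          * star ((w b.tgt : Matrix.specialUnitaryGroup n ℂ) : Matrix n n ℂ) * star ((W b : Matrix.specialUnitaryGroup n ℂ) : Matrix n n ℂ) := by
  show (((w b.src * W b * (w b.tgt)⁻¹ * (W b)⁻¹ : Matrix.specialUnitaryGroup n ℂ)) : Matrix n n ℂ) = _
  rw [Submonoid.coe_mul, Submonoid.coe_mul, Submonoid.coe_mul, ← Matrix.star_eq_inv, ← Matrix.star_eq_inv]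
  rfl

/-- ★ **THE CHART OF A GAUGE COPY IS SECOND-ORDER CLOSE TO ITS COVARIANT GAUGE DIRECTION.**  For `‖w(b₋) − 1‖, ‖w(b₊) − 1‖ ≤ 1∕64`, with `μ := log ∘ w`:
`‖(−i)log↑((W^w)_bW_b⁻¹) − ((−i)μ(b₋) − W_b·((−i)μ(b₊))·W_b*)‖ ≤ 3‖μ(b₋)‖·‖(−i)μ(b₋) − W_b·((−i)μ(b₊))·W_b*‖` — the refined (31) of the lineage read through `(−i)•`.
[cite: Balaban1985Averaging, (31) p.22, (8) p.19, (11) p.19] -/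
theorem norm_chart_gaugeCopy_sub_gaugeDir_le (W : GaugeField P k (Matrix.specialUnitaryGroup n ℂ)) (w : GaugeTransf P k (Matrix.specialUnitaryGroup n ℂ)) (b : PBond P k)
    (hm : ‖((w b.src : Matrix.specialUnitaryGroup n ℂ) : Matrix n n ℂ) - 1‖ ≤ 1 / 64) (hp : ‖((w b.tgt : Matrix.specialUnitaryGroup n ℂ) : Matrix n n ℂ) - 1‖ ≤ 1 / 64) :
    ‖(-Complex.I) • mlog (((GaugeField.gaugeAct w W b * (W b)⁻¹ : Matrix.specialUnitaryGroup n ℂ)) : Matrix n n ℂ)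
        - ((-Complex.I) • mlog ((w b.src : Matrix.specialUnitaryGroup n ℂ) : Matrix n n ℂ)
            - ((W b : Matrix.specialUnitaryGroup n ℂ) : Matrix n n ℂ) * ((-Complex.I) • mlog ((w b.tgt : Matrix.specialUnitaryGroup n ℂ) : Matrix n n ℂ))
                * star ((W b : Matrix.specialUnitaryGroup n ℂ) : Matrix n n ℂ))‖
      ≤ 3 * ‖mlog ((w b.src : Matrix.specialUnitaryGroup n ℂ) : Matrix n n ℂ)‖
          * ‖(-Complex.I) • mlog ((w b.src : Matrix.specialUnitaryGroup n ℂ) : Matrix n n ℂ)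
              - ((W b : Matrix.specialUnitaryGroup n ℂ) : Matrix n n ℂ) * ((-Complex.I) • mlog ((w b.tgt : Matrix.specialUnitaryGroup n ℂ) : Matrix n n ℂ))
                  * star ((W b : Matrix.specialUnitaryGroup n ℂ) : Matrix n n ℂ)‖ := by
  have hnI : ∀ M : Matrix n n ℂ, ‖(-Complex.I) • M‖ = ‖M‖ := fun M => by rw [norm_smul, norm_neg, Complex.norm_I, one_mul]
  have h := norm_mlog_twist_sub_pureGauge_le_refined (w b.src) (w b.tgt) (W b) hm hp
  have e1 : (-Complex.I) • mlog ((w b.src : Matrix.specialUnitaryGroup n ℂ) : Matrix n n ℂ)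
        - ((W b : Matrix.specialUnitaryGroup n ℂ) : Matrix n n ℂ) * ((-Complex.I) • mlog ((w b.tgt : Matrix.specialUnitaryGroup n ℂ) : Matrix n n ℂ))
            * star ((W b : Matrix.specialUnitaryGroup n ℂ) : Matrix n n ℂ)
      = (-Complex.I) • (mlog ((w b.src : Matrix.specialUnitaryGroup n ℂ) : Matrix n n ℂ)
          - ((W b : Matrix.specialUnitaryGroup n ℂ) : Matrix n n ℂ) * mlog ((w b.tgt : Matrix.specialUnitaryGroup n ℂ) : Matrix n n ℂ)
              * star ((W b : Matrix.specialUnitaryGroup n ℂ) : Matrix n n ℂ)) := by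
    rw [smul_sub, mul_smul_comm, smul_mul_assoc]
  rw [e1, coe_gaugeAct_self_mul_inv, ← smul_sub, hnI, hnI]
  exact h

end Letters

/-! ## §2 No non-trivial small gauge copy passes the slice row -/

section GaugeCopy

variable (F : T3Family) {n K : ℕ}

/-- ★★★ **THE ORBIT TEST AT `Y = W^w`.**  `W` any `SU(2)` field on run `K`'s torus with `dist1(W(∂p)) ≤ a`; `w` a gauge transformation with `‖w(x) − 1‖ ≤ 1∕64` and
`3‖log w(x)‖ ≤ h ≤ 1`; `ω(x) := (−i)log w(x)`, `Z_b := ω(b₋) − W_bω(b₊)W_b*`, `D_b := (−i)log↑((W^w)_bW_b⁻¹)` (the doors' chart of the gauge copy, all DISPLAYED); Poincaré rows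
`Σ_x‖ω‖² ≤ P₀·DIV_W(iZ)`, `Σ_b‖Z_b‖² ≤ P₁·DIV_W(iZ)` and window `16ζa²d²P₀ + 64ζd·h²P₁ + 16d·h²P₁ + 8δ₁ℓ⁻²P₁ < 1`.  IF the slice row of ✓ `stub_PV3E_of_fibrePointSlice`
holds at `D`, THEN `(W^w)_b = W_b` for every bond `b` — the copy IS `W`. [cite: Balaban1985Variational, (6) p.278, (141)-(143) p.299, Prop. 7 p.299]
[cite: Balaban1985Averaging, (31) p.22] -/
theorem gaugeCopy_eq_of_sliceRow (W : GaugeField (F.P K) 0 (Matrix.specialUnitaryGroup (Fin 2) ℂ)) {a : ℝ}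
    (hW : ∀ p : Plaq (F.P K) 0, dist1 (GaugeField.plaqHol W p) ≤ a)
    (w : GaugeTransf (F.P K) 0 (Matrix.specialUnitaryGroup (Fin 2) ℂ))
    (hw1 : ∀ x : Site (F.P K) 0, ‖((w x : Matrix.specialUnitaryGroup (Fin 2) ℂ) : Matrix (Fin 2) (Fin 2) ℂ) - 1‖ ≤ 1 / 64)
    {h : ℝ} (hh0 : 0 ≤ h) (hh : h ≤ 1)
    (hμ : ∀ x : Site (F.P K) 0, 3 * ‖mlog (((w x : Matrix.specialUnitaryGroup (Fin 2) ℂ)) : Matrix (Fin 2) (Fin 2) ℂ)‖ ≤ h)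
    (ω : Site (F.P K) 0 → Matrix (Fin 2) (Fin 2) ℂ) (Z D : PBond (F.P K) 0 → Matrix (Fin 2) (Fin 2) ℂ)
    (hω : ∀ x, ω x = (-Complex.I) • mlog (((w x : Matrix.specialUnitaryGroup (Fin 2) ℂ)) : Matrix (Fin 2) (Fin 2) ℂ))
    (hZ : ∀ b : PBond (F.P K) 0, Z b = ω b.src - (W b : Matrix (Fin 2) (Fin 2) ℂ) * ω (b.src.shift b.dir) * star (W b : Matrix (Fin 2) (Fin 2) ℂ))
    (hD : ∀ b : PBond (F.P K) 0, D b = (-Complex.I) • mlog (((GaugeField.gaugeAct w W b * (W b)⁻¹ : Matrix.specialUnitaryGroup (Fin 2) ℂ)) : Matrix (Fin 2) (Fin 2) ℂ))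
    {P₀ P₁ : ℝ}
    (hP₀ : ∑ x : Site (F.P K) 0, ‖ω x‖ ^ 2 ≤ P₀ * (∑ x : Site (F.P K) 0, ∑ j : Fin 2, ∑ k : Fin 2,
            ‖(divB (torusT (F.P K) 0) (fun κ z => unitsField (toUField W) ⟨z, κ⟩) (fun κ z => Complex.I • Z ⟨z, κ⟩) x) j k‖ ^ 2))
    (hP₁ : ∑ b : PBond (F.P K) 0, ‖Z b‖ ^ 2 ≤ P₁ * (∑ x : Site (F.P K) 0, ∑ j : Fin 2, ∑ k : Fin 2,
            ‖(divB (torusT (F.P K) 0) (fun κ z => unitsField (toUField W) ⟨z, κ⟩) (fun κ z => Complex.I • Z ⟨z, κ⟩) x) j k‖ ^ 2))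
    {ζ δ₁ : ℝ} (hζ : 0 ≤ ζ) (hδ₁ : 0 ≤ δ₁)
    (hwin : 16 * ζ * a ^ 2 * ((F.P K).d : ℝ) ^ 2 * P₀ + 64 * ζ * (F.P K).d * h ^ 2 * P₁ + 16 * (F.P K).d * h ^ 2 * P₁
        + 8 * δ₁ * (((F.L : ℝ) ^ (K - n)) ^ 2)⁻¹ * P₁ < 1)
    (hrow : (∑ x : Site (F.P K) 0, ∑ j : Fin 2, ∑ k : Fin 2,
            ‖(divB (torusT (F.P K) 0) (fun κ z => unitsField (toUField W) ⟨z, κ⟩) (fun κ z => Complex.I • D ⟨z, κ⟩) x) j k‖ ^ 2)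
          ≤ ζ * (∑ p : Plaq (F.P K) 0, ‖((Complex.I • D ⟨p.src, p.μ⟩) + ((W ⟨p.src, p.μ⟩ : Matrix (Fin 2) (Fin 2) ℂ) * (Complex.I • D ⟨p.src.shift p.μ, p.ν⟩) * star (W ⟨p.src, p.μ⟩ : Matrix (Fin 2) (Fin 2) ℂ))
            - (((W ⟨p.src, p.μ⟩ * W ⟨p.src.shift p.μ, p.ν⟩ * (W ⟨p.src.shift p.ν, p.μ⟩)⁻¹ : Matrix.specialUnitaryGroup (Fin 2) ℂ) : Matrix (Fin 2) (Fin 2) ℂ) * (Complex.I • D ⟨p.src.shift p.ν, p.μ⟩) * star ((W ⟨p.src, p.μ⟩ * W ⟨p.src.shift p.μ, p.ν⟩ * (W ⟨p.src.shift p.ν, p.μ⟩)⁻¹ : Matrix.specialUnitaryGroup (Fin 2) ℂ) : Matrix (Fin 2) (Fin 2) ℂ))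
            - (((GaugeField.plaqHol W p : Matrix.specialUnitaryGroup (Fin 2) ℂ) : Matrix (Fin 2) (Fin 2) ℂ) * (Complex.I • D ⟨p.src, p.ν⟩) * star ((GaugeField.plaqHol W p : Matrix.specialUnitaryGroup (Fin 2) ℂ) : Matrix (Fin 2) (Fin 2) ℂ)))‖ ^ 2)
              + δ₁ * (((F.L : ℝ) ^ (K - n)) ^ 2)⁻¹ * ∑ b : PBond (F.P K) 0, ‖D b‖ ^ 2) :
    ∀ b : PBond (F.P K) 0, GaugeField.gaugeAct w W b = W b := by
  -- second-order closeness of the chart to the gauge direction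
  have hN : ∀ b : PBond (F.P K) 0, ‖D b - Z b‖ ≤ h * ‖Z b‖ := by
    intro b
    have hZb : Z b = (-Complex.I) • mlog ((w b.src : Matrix.specialUnitaryGroup (Fin 2) ℂ) : Matrix (Fin 2) (Fin 2) ℂ)
        - ((W b : Matrix.specialUnitaryGroup (Fin 2) ℂ) : Matrix (Fin 2) (Fin 2) ℂ) * ((-Complex.I) • mlog ((w b.tgt : Matrix.specialUnitaryGroup (Fin 2) ℂ) : Matrix (Fin 2) (Fin 2) ℂ))
            * star ((W b : Matrix.specialUnitaryGroup (Fin 2) ℂ) : Matrix (Fin 2) (Fin 2) ℂ) := by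
      rw [hZ b, hω, hω]; rfl
    have h1 := norm_chart_gaugeCopy_sub_gaugeDir_le W w b (hw1 b.src) (hw1 b.tgt)
    rw [← hZb, ← hD b] at h1
    have h0 : 0 ≤ ‖Z b‖ := norm_nonneg _
    calc ‖D b - Z b‖ ≤ 3 * ‖mlog ((w b.src : Matrix.specialUnitaryGroup (Fin 2) ℂ) : Matrix (Fin 2) (Fin 2) ℂ)‖ * ‖Z b‖ := h1
      _ ≤ h * ‖Z b‖ := mul_le_mul_of_nonneg_right (hμ b.src) h0
  have hD0 := (pinnedGauge_eq_zero_of_sliceRow F W hW ω Z D hZ hh0 hh hN hP₀ hP₁ hζ hδ₁ hwin hrow).2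
  intro b
  -- `(−I)•log(ratio) = 0 ⇒ log(ratio) = 0 ⇒ ratio = e^0 = 1`
  have hlog : mlog (((GaugeField.gaugeAct w W b * (W b)⁻¹ : Matrix.specialUnitaryGroup (Fin 2) ℂ)) : Matrix (Fin 2) (Fin 2) ℂ) = 0 := by
    have h := hD0 b
    rw [hD b, smul_eq_zero] at h
    rcases h with h | h
    · exact absurd h (neg_ne_zero.mpr Complex.I_ne_zero)
    · exact h
  have hclose : ‖(((GaugeField.gaugeAct w W b * (W b)⁻¹ : Matrix.specialUnitaryGroup (Fin 2) ℂ)) : Matrix (Fin 2) (Fin 2) ℂ) - 1‖ < 1 := by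
    rw [coe_gaugeAct_self_mul_inv]
    have h1 := (norm_twist_sub_one_le (w b.src) (w b.tgt) (W b)).trans (norm_sub_conj_le (w b.src) (w b.tgt) (W b))
    linarith [hw1 b.src, hw1 b.tgt]
  have hone : (((GaugeField.gaugeAct w W b * (W b)⁻¹ : Matrix.specialUnitaryGroup (Fin 2) ℂ)) : Matrix (Fin 2) (Fin 2) ℂ) = 1 := by
    rw [← exp_mlog hclose, hlog, exp_zero]
  have hgrp : GaugeField.gaugeAct w W b * (W b)⁻¹ = 1 := Subtype.ext hone
  exact mul_inv_eq_one.mp hgrp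

end GaugeCopy

end Summit.QuantumFields.YangMills.Theorems.Prop7PinnedOrbitSliceRowGaugeCopy

end
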